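import Literature.MathematicalPhysics.QuantumFieldTheory.Sweep1
import HarnessLib

/-!
# Chatterjee's large-`N` solution of strongly coupled `SO(N)` lattice gauge theory: the theorems for rectangular Wilson loops

S. Chatterjee, *Rigorous solution of strongly coupled `SO(N)` lattice gauge theory in the large
`N` limit*, Commun. Math. Phys. **366** (2019) 203–268, arXiv:1502.07719 [Chatterjee2019LargeN],
§3 "Main result and corollaries": **Theorem 3.1** (existence of the 't Hooft limit of Wilson
loop expectations for `|β| ≤ β₀(d)` as an absolutely convergent sum over vanishing string
trajectories), **Corollary 3.2** (factorisation of Wilson loops), **Corollary 3.3** (area law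
upper bound in the 't Hooft limit), **Corollary 3.4** (limiting log-partition function),
**Corollary 3.5** (real analyticity at strong coupling); arXiv v7 = CMP numbering.

Cross-ladder literature-typing layer (D-0088; R141 (D) item (3b)): statements only, as named
facts `def … : Prop` (D-0014), each PROVED in the source, in the tree's free-boundary `ℤᵈ`
vocabulary of `Sweep1` (`ZdGaugeConfig`, `plaquettesIn`, `zdWilsonMeasure`/`zdExpect ρ β Λ`,
`zdWilsonLoop ρ x i j R T = N⁻¹ Re tr ρ(hol ∂[R×T])`, `zdPartitionFunction`). The tree cites the
paper only in prose (`Barriers/QuantumFields/GrossWittenTransition`, `EguchiKawaiBreakdown`: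
Thm 3.1, Cor 3.5 and the §18 open problems); no statement of it was typed before this file.

## Scope of the transcription: rectangular loops

The printed theorems are about arbitrary loops and loop sequences (non-backtracking cycles in
`ℤᵈ`, §2.1) and the right-hand side of Thm 3.1 is a sum over the lattice string theory of §2.2
(deformations, splittings, mergers, twistings, vanishing trajectories, weights `w_β`). That
vocabulary is not in the tree (the Summit-side `GaugeBoot` lattice words are not importable into
Literature), and typing it is a separate, definition-heavy task. This file therefore transcribes
the theorems for the loops the tree HAS — the boundaries `∂[R×T]` of lattice rectangles
(`ZdGaugeConfig.rectangle`, `zdWilsonLoop`), the loops of the area law, string tension and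
Problem 4.1 of [ChatterjeeYMProb2019] — and renders the string-theoretic right-hand sides by what
the corollaries extract from them: EXISTENCE of the limit, its INDEPENDENCE of the exhausting
sequence `Λ_N` and of the realisation of `SO(N)`, its real-ANALYTIC dependence on `β`
(Cor 3.5: `= ∑ₖ a_k(s) βᵏ`, absolutely convergent, `a_k(s)` determined by the loop sequence `s`
alone), FACTORISATION (Cor 3.2) and the AREA-LAW bound (Cor 3.3, with `area(∂[R×T]) = RT`). Every
fact below is thus a special case / consequence of the printed statement, never stronger.

## Dictionary

* Chatterjee's measure (§3): `dμ_{Λ,N,β}(Q) = Z⁻¹ exp (Nβ ∑_{p ∈ 𝒫⁺_Λ} tr Q_p) ∏_{e ∈ E⁺_Λ} dσ_N(Q_e)`,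
  `𝒫⁺_Λ` = positively oriented plaquettes with all vertices in `Λ` (each geometric plaquette
  once; `tr Q_p` is orientation-blind on `SO(N)` since `tr Qᵀ = tr Q`). The tree's
  `zdWilsonMeasure ρ β' Λ` has density `exp (−β' ∑_{p ∈ plaquettesIn Λ} (N − Re tr ρ(U_p)))`
  against the infinite product Haar measure, `plaquettesIn Λ` = squares with all four corners in
  `Λ`; so `μ_{Λ,N,β} = zdWilsonMeasure ρ (N β) Λ` for a model `ρ` of `SO(N)` (the constant
  `e^{−Nβ'|𝒫|}` cancels; edges off `Λ` are independent Haar and invisible to loops inside `Λ`),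
  i.e. **`β' = N β`** ('t Hooft scaling), and
  `Z_{Λ,N,β} = e^{N²β |plaquettesIn Λ|} · zdPartitionFunction ρ (Nβ) Λ`.
* `G = SO(N)`: as for Sweep1's `IsSpecialUnitaryModel`, an abstract compact group `G` with a
  continuous faithful representation `ρ : G →* M_N(ℂ)` whose image is exactly `SO(N) ⊆ M_N(ℝ) ⊆
  M_N(ℂ)` (`IsSpecialOrthogonalModel`); Haar on `G` is then Chatterjee's `σ_N`. The large-`N`
  limit runs over a family `(G_N, ρ_N)_N` of such models.
* `W_l = tr(Q_{e₁} ⋯ Q_{eₙ})` (un-normalised), so `⟨W_l⟩/N = zdExpect ρ (Nβ) Λ (zdWilsonLoop ρ x i j R T)`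
  for `l = ∂[R×T]` based at `x` in the `(i, j)` plane (`zdWilsonLoop` carries the `N⁻¹` and
  `Re tr = tr` on real matrices).
* `Λ_1 ⊆ Λ_2 ⊆ ⋯`, `⋃ Λ_N = ℤᵈ`: `Monotone Λ ∧ ∀ y, ∃ N, y ∈ Λ N`; the loop lies in `E_{Λ_N}` for
  all large `N`, which is all a limit statement sees.

Not transcribed: Thm 3.1's trajectory-sum formula itself and general loop sequences; Thm 3.6
(finite-`N` master loop equation); §4 (the algorithm for `a_k`); §18 open problems (already
quoted in `GrossWittenTransition`).
-/

noncomputable section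

open MeasureTheory Filter Topology
open scoped ENNReal

namespace Literature.MathematicalPhysics.QuantumFieldTheory

namespace ChatterjeeLargeN

variable {N : ℕ} {G : Type*} [Group G] [TopologicalSpace G]

/-- "`G = SO(N)`": `ρ` is a continuous faithful representation of the compact group `G` by complex
`N × N` matrices whose image is exactly the real special orthogonal group `SO(N)` (embedded by
`ℝ ⊆ ℂ` entrywise), so that `G ≅ SO(N)` as compact groups and normalised Haar measure on `G` is
Chatterjee's `σ_N` (§3: "Let `SO(N)` be the group of `N × N` orthogonal matrices with determinant
`1`, and let `σ_N` be the Haar measure on `SO(N)`"). Pattern of Sweep1's `IsSpecialUnitaryModel`.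
[cite: Chatterjee2019LargeN, §3 (first paragraph: SO(N), σ_N)] -/
def IsSpecialOrthogonalModel (ρ : G →* Matrix (Fin N) (Fin N) ℂ) : Prop :=
  Continuous ρ ∧ Function.Injective ρ ∧
    Set.range ρ =
      (fun M : Matrix (Fin N) (Fin N) ℝ => M.map (algebraMap ℝ ℂ)) ''
        (Matrix.specialOrthogonalGroup (Fin N) ℝ : Set (Matrix (Fin N) (Fin N) ℝ))

end ChatterjeeLargeN

open ChatterjeeLargeN

/-! ### Large-`N` families of `SO(N)` models

A large-`N` family in the sense of §3 and Thm 3.1 is: for every rank `N` a compact group `G N`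
(Borel structure) with a representation `ρ N` realising it as `SO(N)` (`IsSpecialOrthogonalModel`),
and an increasing exhausting sequence of finite regions `Λ_1 ⊆ Λ_2 ⊆ ⋯ ⊆ ℤᵈ`, `⋃_N Λ_N = ℤᵈ`
("Let `Λ_1, Λ_2, …` be any sequence of finite subsets of `ℤᵈ` such that `Λ_1 ⊆ Λ_2 ⊆ ⋯` and
`ℤᵈ = ∪ Λ_N`"). No structure is bundled (typer lint: no instance attributes); the facts quantify
over the family with explicit instance binders, and the three observables below take it as
arguments. -/

section Family

variable {d : ℕ} (G : ℕ → Type) [∀ N, Group (G N)] [∀ N, TopologicalSpace (G N)]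
  [∀ N, IsTopologicalGroup (G N)] [∀ N, CompactSpace (G N)] [∀ N, MeasurableSpace (G N)]
  [∀ N, BorelSpace (G N)] (ρ : ∀ N, G N →* Matrix (Fin N) (Fin N) ℂ)
  (Λ : ℕ → Finset (Literature.Probability.LatticeModels.Site d))

/-- Chatterjee's normalised rectangular Wilson loop expectation at rank `N`,
`⟨W_{∂[R×T]}⟩_{Λ_N, N, β} / N = zdExpect (ρ N) (N β) (Λ N) (zdWilsonLoop (ρ N) x i j R T)`
('t Hooft scaling `β' = Nβ` of the tree's inverse coupling; module docstring, Dictionary).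
[cite: Chatterjee2019LargeN, §3 (μ_{Λ,N,β}, ⟨f⟩ (3.1), W_l)] -/
def largeNLoopExpect (β : ℝ) (N : ℕ) (x : Literature.Probability.LatticeModels.Site d)
    (i j : Fin d) (R T : ℕ) : ℝ :=
  zdExpect (ρ N) (N * β) (Λ N) (zdWilsonLoop (ρ N) x i j R T)

/-- The expectation of a product of normalised rectangular Wilson loops at rank `N`,
`⟨W_{l₁} ⋯ W_{lₙ}⟩_{Λ_N, N, β} / Nⁿ`, the loops `l_k = ∂[R_k × T_k]` based at `x_k` in the plane
`(i_k, j_k)`. [cite: Chatterjee2019LargeN, Thm 3.1 (the left-hand side)] -/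
def largeNProdLoopExpect (β : ℝ) (N : ℕ) {n : ℕ}
    (x : Fin n → Literature.Probability.LatticeModels.Site d) (i j : Fin n → Fin d)
    (R T : Fin n → ℕ) : ℝ :=
  zdExpect (ρ N) (N * β) (Λ N) fun U =>
    ∏ k, zdWilsonLoop (ρ N) (x k) (i k) (j k) (R k) (T k) U

/-- Chatterjee's log-partition function at rank `N`, `log Z_{Λ_N, N, β}` with
`Z = ∫ exp (Nβ ∑_{p ∈ 𝒫⁺_Λ} tr Q_p) ∏ dσ_N = e^{N²β |𝒫⁺_{Λ_N}|} · zdPartitionFunction (ρ N) (Nβ) (Λ N)`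
(the tree's weight is `exp (−β' ∑ₚ (N − Re tr))`; module docstring, Dictionary).
[cite: Chatterjee2019LargeN, §3 (Z_{Λ,N,β}) and Cor 3.4] -/
def largeNLogPartition (β : ℝ) (N : ℕ) : ℝ :=
  Real.log (zdPartitionFunction (ρ N) (N * β) (Λ N)).toReal +
    (N : ℝ) ^ 2 * β * ((plaquettesIn (Λ N)).card : ℝ)

end Family

/-- **Theorem 3.1 with Corollary 3.5, for rectangular loops** (Chatterjee 2019; named fact,
D-0014 — proved in the source). *Printed (Thm 3.1):* "There exists a number `β₀(d) > 0`,
depending only on the dimension `d`, such that the following is true. Let `Λ_1 ⊆ Λ_2 ⊆ ⋯` be any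
sequence of finite subsets of `ℤᵈ` [with] `ℤᵈ = ∪ Λ_N`. If `|β| ≤ β₀(d)`, then for any loop
sequence `s` with minimal representation `(l_1, …, l_n)`,
`lim_{N→∞} ⟨W_{l_1} ⋯ W_{l_n}⟩_{Λ_N,N,β} / Nⁿ = ∑_{X ∈ 𝒳(s)} w_β(X)`, … absolutely convergent";
*(Cor 3.5):* for `|β| ≤ β₀(d)` this limit "`= ∑_{k=0}^∞ a_k(s) βᵏ`, where
`a_k(s) = ∑_{X ∈ 𝒳_k(s)} v(X)`, and the infinite series is absolutely convergent" — `a_k(s)`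
depends on the loop sequence `s` only. *Rendered* for a single rectangular loop `l = ∂[R×T]`
based at `x` in the plane `(i, j)`, `i ≠ j`, `R, T ≥ 1`, `d ≥ 2`: there is `β₀ > 0` depending only
on `d`, and for each such loop coefficients `a : ℕ → ℝ` with `∑ |a_k| β₀ᵏ < ∞`, such that for
EVERY large-`N` family of `SO(N)` models `(G N, ρ N)` and increasing exhausting regions `Λ_N`
and every `|β| ≤ β₀`, `⟨W_l⟩_{Λ_N,N,β}/N → ∑ₖ a_k βᵏ` as `N → ∞`. The identification of `a_k`
with trajectory counts is not transcribed (module docstring). [cite: Chatterjee2019LargeN, Thm 3.1 and Cor 3.5 (§3); proofs §§5–16] -/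
def chatterjee_largeN_rectLoop : Prop :=
  ∀ (d : ℕ), 2 ≤ d → ∃ β₀ : ℝ, 0 < β₀ ∧
    ∀ (x : Literature.Probability.LatticeModels.Site d) (i j : Fin d) (R T : ℕ),
      i ≠ j → 1 ≤ R → 1 ≤ T →
      ∃ a : ℕ → ℝ, Summable (fun k => |a k| * β₀ ^ k) ∧
        ∀ (G : ℕ → Type) [∀ N, Group (G N)] [∀ N, TopologicalSpace (G N)]
          [∀ N, IsTopologicalGroup (G N)] [∀ N, CompactSpace (G N)] [∀ N, MeasurableSpace (G N)]
          [∀ N, BorelSpace (G N)] (ρ : ∀ N, G N →* Matrix (Fin N) (Fin N) ℂ),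
          (∀ N, IsSpecialOrthogonalModel (ρ N)) →
        ∀ Λ : ℕ → Finset (Literature.Probability.LatticeModels.Site d), Monotone Λ →
          (∀ y, ∃ N, y ∈ Λ N) →
        ∀ β : ℝ, |β| ≤ β₀ →
          Tendsto (fun N => largeNLoopExpect G ρ Λ β N x i j R T) atTop
            (𝓝 (∑' k, a k * β ^ k))

/-- **Corollary 3.2, for rectangular loops** (factorisation of Wilson loops in the large-`N`
limit; named fact, D-0014 — proved in the source, §13). *Printed:* "suppose that `|β| ≤ β₀(d)`.
Then for any non-null loops `l_1, …, l_n`,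
`lim_{N→∞} ⟨W_{l_1} ⋯ W_{l_n}⟩_{Λ_N,N,β} / Nⁿ = lim_{N→∞} ∏ᵢ ⟨W_{l_i}⟩_{Λ_N,N,β} / N`. In
particular … `W_l/N` converges in probability to the (deterministic) limit of `⟨W_l⟩/N`."
*Rendered* for rectangular loops `l_k = ∂[R_k×T_k]` (`i_k ≠ j_k`, `R_k, T_k ≥ 1`), with the
`β₀(d)` clause of Thm 3.1 and WITHOUT re-asserting that the two limits exist (weaker than print):
the difference `⟨∏ W_{l_k}/N⟩_{Λ_N,N,β} − ∏ ⟨W_{l_k}/N⟩_{Λ_N,N,β}` tends to `0`; the case `n = 2`,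
`l_1 = l_2` is the vanishing of `Var(W_l/N)`. [cite: Chatterjee2019LargeN, Cor 3.2 (§3); proof §13] -/
def chatterjee_largeN_factorization : Prop :=
  ∀ (d : ℕ), 2 ≤ d → ∃ β₀ : ℝ, 0 < β₀ ∧
    ∀ (G : ℕ → Type) [∀ N, Group (G N)] [∀ N, TopologicalSpace (G N)]
      [∀ N, IsTopologicalGroup (G N)] [∀ N, CompactSpace (G N)] [∀ N, MeasurableSpace (G N)]
      [∀ N, BorelSpace (G N)] (ρ : ∀ N, G N →* Matrix (Fin N) (Fin N) ℂ),
      (∀ N, IsSpecialOrthogonalModel (ρ N)) →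
    ∀ Λ : ℕ → Finset (Literature.Probability.LatticeModels.Site d), Monotone Λ →
      (∀ y, ∃ N, y ∈ Λ N) →
    ∀ β : ℝ, |β| ≤ β₀ →
      ∀ (n : ℕ) (x : Fin n → Literature.Probability.LatticeModels.Site d) (i j : Fin n → Fin d)
        (R T : Fin n → ℕ), (∀ k, i k ≠ j k) → (∀ k, 1 ≤ R k) → (∀ k, 1 ≤ T k) →
        Tendsto
          (fun N => largeNProdLoopExpect G ρ Λ β N x i j R T -
            ∏ k, largeNLoopExpect G ρ Λ β N (x k) (i k) (j k) (R k) (T k))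
          atTop (𝓝 0)

/-- **Corollary 3.3, for rectangular loops** (area law upper bound in the 't Hooft limit; named
fact, D-0014 — proved in the source, §14). *Printed:* "for any non-null loop `l`,
`lim_{N→∞} |⟨W_l⟩|/N ≤ (C(d)|β|)^{area(l)}`, where `C(d)` is a positive constant that depends only
on the dimension `d`, and `area(l)` is the area of the minimal lattice surface enclosed by `l`"
(notation of Thm 3.1, so `|β| ≤ β₀(d)`). *Rendered* for `l = ∂[R×T]` (`i ≠ j`, `R, T ≥ 1`), whose
minimal lattice surface has area `RT` ("If `l` lies on a coordinate plane, there is usually no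
ambiguity about the meaning of 'area enclosed by `l`'", §3), and with `limsup` in place of the
limit (which exists by Thm 3.1; weaker than print): there are `β₀, C > 0` depending only on `d`
with `limsup_N |⟨W_l⟩_{Λ_N,N,β}|/N ≤ (C|β|)^{RT}` for every large-`N` family and `|β| ≤ β₀`.
[cite: Chatterjee2019LargeN, Cor 3.3 (§3); proof §14] -/
def chatterjee_largeN_areaLaw : Prop :=
  ∀ (d : ℕ), 2 ≤ d → ∃ β₀ C : ℝ, 0 < β₀ ∧ 0 < C ∧
    ∀ (G : ℕ → Type) [∀ N, Group (G N)] [∀ N, TopologicalSpace (G N)]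
      [∀ N, IsTopologicalGroup (G N)] [∀ N, CompactSpace (G N)] [∀ N, MeasurableSpace (G N)]
      [∀ N, BorelSpace (G N)] (ρ : ∀ N, G N →* Matrix (Fin N) (Fin N) ℂ),
      (∀ N, IsSpecialOrthogonalModel (ρ N)) →
    ∀ Λ : ℕ → Finset (Literature.Probability.LatticeModels.Site d), Monotone Λ →
      (∀ y, ∃ N, y ∈ Λ N) →
    ∀ β : ℝ, |β| ≤ β₀ →
      ∀ (x : Literature.Probability.LatticeModels.Site d) (i j : Fin d) (R T : ℕ),
        i ≠ j → 1 ≤ R → 1 ≤ T →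
        limsup (fun N => |largeNLoopExpect G ρ Λ β N x i j R T|) atTop ≤ (C * |β|) ^ (R * T)

/-- **Corollary 3.4 with Corollary 3.5 (limiting log-partition function)** (named fact, D-0014 —
proved in the source, §§15–16). *Printed (Cor 3.4):* "Let `M_N` be a sequence of integers
increasing to infinity, and suppose that `Λ_N = [−M_N, M_N]ᵈ ∩ ℤᵈ`. Let `p` be any plaquette. Then
`lim_{N→∞} log Z_{Λ_N,N,β} / (N²|Λ_N|) = (β d(d−1)/2) ∑_{X ∈ 𝒳(p)} w_β(X)/(δ(X)+1)`";
*(Cor 3.5, second display):* "`= (d(d−1)/2) ∑_{k=0}^∞ a_k(s) β^{k+1}/(k+1)`, where, again, the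
series is absolutely convergent", `a_k = a_k(p)` the coefficients of the plaquette loop `p` in the
first display of Cor 3.5 (`lim ⟨W_p⟩/N = ∑ a_k(p) βᵏ`). *Rendered:* for `d ≥ 2` there is
`β₀(d) > 0` and coefficients `a : ℕ → ℝ`, `∑ |a_k| β₀ᵏ < ∞`, such that for every large-`N`
family of `SO(N)` models whose regions are the centred cubes `Λ_N = box d (M N) = {−M_N, …, M_N}ᵈ`
with `M_N` strictly increasing ("a sequence of integers increasing to infinity"), every `|β| ≤ β₀`, and every plaquette `(x; i ≠ j)`:
(a) `⟨W_p⟩/N → ∑ a_k βᵏ` (this pins `a` down as the plaquette coefficients) and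
(b) `log Z_{Λ_N,N,β}/(N² |Λ_N|) → (d(d−1)/2) ∑ₖ a_k β^{k+1}/(k+1)`, with `log Z` in Chatterjee's
normalisation (`largeNLogPartition`, module docstring). [cite: Chatterjee2019LargeN, Cor 3.4 and Cor 3.5 (§3); proofs §§15–16] -/
def chatterjee_largeN_logPartition : Prop :=
  ∀ (d : ℕ), 2 ≤ d → ∃ β₀ : ℝ, 0 < β₀ ∧ ∃ a : ℕ → ℝ, Summable (fun k => |a k| * β₀ ^ k) ∧
    ∀ (G : ℕ → Type) [∀ N, Group (G N)] [∀ N, TopologicalSpace (G N)]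
      [∀ N, IsTopologicalGroup (G N)] [∀ N, CompactSpace (G N)] [∀ N, MeasurableSpace (G N)]
      [∀ N, BorelSpace (G N)] (ρ : ∀ N, G N →* Matrix (Fin N) (Fin N) ℂ),
      (∀ N, IsSpecialOrthogonalModel (ρ N)) →
    ∀ (M : ℕ → ℕ), StrictMono M →
    ∀ β : ℝ, |β| ≤ β₀ →
      (∀ (x : Literature.Probability.LatticeModels.Site d) (i j : Fin d), i ≠ j →
        Tendsto
          (fun N => largeNLoopExpect G ρ
            (fun N => Literature.Probability.LatticeModels.box d (M N)) β N x i j 1 1)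
          atTop (𝓝 (∑' k, a k * β ^ k))) ∧
      Tendsto
        (fun N => largeNLogPartition G ρ
            (fun N => Literature.Probability.LatticeModels.box d (M N)) β N /
          ((N : ℝ) ^ 2 * ((Literature.Probability.LatticeModels.box d (M N)).card : ℝ)))
        atTop
        (𝓝 ((d : ℝ) * ((d : ℝ) - 1) / 2 * ∑' k, a k * β ^ (k + 1) / ((k : ℝ) + 1)))

end Literature.MathematicalPhysics.QuantumFieldTheory
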